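import Literature.Analysis.FluidPDE.PressureNormalisationL3
import Literature.Analysis.FluidPDE.MildSolutionProofs
import HarnessLib

/-!
# Classical solutions with `L³` slices are mild solutions (Fabes–Jones–Rivière in `L³`)

Analysis/FluidPDE proofs file (theorems only) on the discharge path of
`Literature.Analysis.FluidPDE.chaeWolf2017_dss_typeI_decay` (Chae–Wolf 2017, Thm. 1.1, case
`p = 3`). It proves the `L³` twin of the tree's
`IsClassicalNSSolutionOn.isMildNSSolutionOn_holds` (`MildSolutionProofs.lean`; Fabes–Jones–Rivière,
Arch. Rational Mech. Anal. 45 (1972), Thm. 2.1 (i): classical solutions with **bounded** `u`, `p`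
are mild solutions in duality form): a classical solution `(u, p)` of the unforced Navier–Stokes
system (`ν > 0`) on an open time interval `(t₁, t₂) ∋ 0` whose slices lie in `L³(ℝ³)` with
`sup_t ‖u(t)‖_{L³} < ∞` satisfies the duality identity from the datum `u 0`,
`∫⟪u t, φ⟫ = ∫⟪u 0, e^{νtΔ}φ⟫ + ∫₀ᵗ ∫⟪u, (u·∇)e^{ν(t-τ)Δ}φ⟫`, for `0 ≤ t < t₂` and every smooth
compactly supported divergence-free `φ` (`isMildNSSolutionFrom_of_memLp_three`), hence is a mild
solution on `[0, T)` for `T ≤ t₂` (`isMildNSSolutionOn_of_memLp_three`). No boundedness of `u`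
or `p` is assumed: the pressure is first normalised — by
`PressureNormalisationL3.pressure_ae_eq_rieszPressure_add_const` (Tao 2011, Lemma 4.1 (i) in
`L³`), `p(τ) = Π[u(τ)] + C(τ)` a.e. with `Π[u(τ)] ∈ L^{3/2}` the Riesz pressure — and the
constant `C(τ)` drops out of the cut-off pressure term since `∫ Dχ_R(ψ) = ∫ div(χ_R ψ) = 0` for
the divergence-free caloric test field `ψ`.

## Proof

Steps 1–2 of `MildSolutionProofs` are reused verbatim (`cutoff_duality_ftc`: the fundamental
theorem of calculus for `g(τ) = ∫⟪u(τ), χ_R e^{ν(t-τ)Δ}φ⟫`; `integral_duality_slice_eq`: the slice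
expansion with the pressure term `p Dχ_R·ψ` kept). Step 3 (the limit `R → ∞`) is redone with
integrable — instead of bounded — dominators: with `M = sup ‖u‖_{L³}`, `Cφ = sup|φ|`,
`C_D = sup‖Dφ‖` (which bound the caloric field `ψ(τ) = e^{ν(t-τ)Δ}φ` and its derivative), the
cut-off integrand with `p` replaced by `Π[u(τ)]` is dominated, uniformly in `R ≥ 1`, by
`A₁‖u‖³ + A₂‖ψ‖ + A₃‖Dψ‖ + A₄|Π|^{3/2}` via the elementary inequalities
`a²b ≤ (2a³ + b³)/3`, `ab ≤ a³/3 + (2/3)c b` (`b ≤ c²`), `b³ ≤ C²b` (`b ≤ C`) and Young's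
inequality `|Π| b ≤ (2/3)|Π|^{3/2} + b³/3`; its integral is bounded uniformly in `τ` by
`A₁M³ + A₂‖φ‖₁ + A₃‖Dφ‖₁ + A₄(C_{3/2}M²)^{3/2}` (`L¹`-contraction of the heat flow); dominated
convergence in `x`, then in `τ`, and in the boundary term at `τ = 0` (dominator
`‖u 0‖³/3 + (2/3)√Cφ ‖e^{νtΔ}φ‖`).

## Mathlib / tree search

Tree: `IsClassicalNSSolutionOn.cutoff_duality_ftc`, `.integral_duality_slice_eq`,
`tendsto_integral_cutoff_mul`, `cutoff`, `exists_norm_fderiv_cutoff_le`,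
`exists_abs_laplacian_cutoff_le`, `fderiv_cutoff_eq_zero`, `laplacian_cutoff_eq_zero`,
`tsupport_cutoff_subset`, `heatTest`, `heatFlow`, `norm_heatFlow_le`, `integral_norm_heatFlow_le`,
`integrable_heatFlow`, `fderiv_heatFlow`, `contDiff_heatFlow`, `isDivFree_heatFlow`,
`continuous_uncurry_heatTest_sub` (`MildSolutionProofs`, `WholeSpaceIBP`);
`PressureNormalisationL3.pressure_ae_eq_rieszPressure_add_const`, `memLp_rieszPressure`,
`PressureNormalisationL3.toReal_eLpNorm_rieszPressure_le`,
`integral_fderiv_apply_eq_zero_of_isDivFree` (`TaoEnergyLocalisationProofs`: `∫ Dχ(ψ) = 0` for a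
`C¹_c` cutoff `χ` and a `C¹` divergence-free `ψ`). Mathlib: `Real.young_inequality`,
`MemLp.eLpNorm_eq_integral_rpow_norm`, `MemLp.integrable_norm_rpow`,
`tendsto_integral_filter_of_dominated_convergence`,
`intervalIntegral.tendsto_integral_filter_of_dominated_convergence`.

## References

* E. B. Fabes, B. F. Jones, N. M. Rivière, *The initial value problem for the Navier–Stokes
  equations with data in `L^p`*, Arch. Rational Mech. Anal. 45 (1972) 222–240, Thm. 2.1.
  [FabesJonesRiviere1972]
* T. Tao, Anal. PDE 6 (2013) = arXiv:1108.1165, Lemma 4.1 (i). [Tao2011]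
* D. Chae, J. Wolf, Comm. PDE 42 (2017) = arXiv:1610.09464, Thm. 1.1. [ChaeWolf2017RemovingDSS]
-/

noncomputable section

open MeasureTheory TopologicalSpace Set Function Filter Metric
open _root_.Topology _root_.InnerProductSpace
open scoped RealInnerProductSpace ENNReal NNReal Laplacian ContDiff

namespace Literature.Analysis.FluidPDE

namespace ClassicalL3Mild

/-! ### Elementary inequalities -/

/-- `a²b ≤ (2a³ + b³)/3` for `a, b ≥ 0` (AM–GM: `(a − b)²(2a + b) ≥ 0`). [folklore] -/
private theorem sq_mul_le {a b : ℝ} (ha : 0 ≤ a) (hb : 0 ≤ b) :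
    a ^ 2 * b ≤ 2 / 3 * a ^ 3 + 1 / 3 * b ^ 3 := by
  nlinarith [mul_nonneg (sq_nonneg (a - b)) (by positivity : (0 : ℝ) ≤ 2 * a + b)]

/-- `ab ≤ a³/3 + (2/3) c b` for `a, b ≥ 0` and `b ≤ c²`, `c ≥ 0` (from `(a − c)²(a + 2c) ≥ 0`
and `b ≤ c²`). [folklore] -/
private theorem mul_le_of_le_sq {a b c : ℝ} (ha : 0 ≤ a) (hb : 0 ≤ b) (hc : 0 ≤ c) (hbc : b ≤ c ^ 2) :
    a * b ≤ a ^ 3 / 3 + 2 / 3 * c * b := by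
  -- `3 a c² ≤ a³ + 2c³`, multiplied by `b / (3c²)` (or `c = 0`)
  have key : 0 ≤ (a - c) ^ 2 * (a + 2 * c) := mul_nonneg (sq_nonneg _) (by positivity)
  rcases hc.eq_or_lt with h0 | hc0
  · subst h0
    have hb0 : b = 0 := le_antisymm (by simpa using hbc) hb
    subst hb0
    simp only [mul_zero, add_zero]
    positivity
  · have h1 : 3 * a * c ^ 2 * b ≤ (a ^ 3 + 2 * c ^ 3) * b := by nlinarith
    have h2 : a ^ 3 * b ≤ a ^ 3 * c ^ 2 := mul_le_mul_of_nonneg_left hbc (by positivity)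
    have hc2 : 0 < c ^ 2 := by positivity
    -- divide by `3 c²`
    have h3 : a * b = (3 * a * c ^ 2 * b) / (3 * c ^ 2) := by field_simp
    rw [h3, div_le_iff₀ (by positivity)]
    nlinarith

/-- `b³ ≤ C² b` for `0 ≤ b ≤ C`. [folklore] -/
private theorem pow_three_le {b C : ℝ} (hb0 : 0 ≤ b) (hb : b ≤ C) : b ^ 3 ≤ C ^ 2 * b := by
  have hC : 0 ≤ C := hb0.trans hb
  nlinarith [mul_le_mul hb hb hb0 hC, mul_nonneg hb0 hb0]

/-- **Young's inequality `|Q| b ≤ (2/3)|Q|^{3/2} + b³/3`** for `b ≥ 0` (exponents `3/2`, `3`). [folklore] -/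
private theorem abs_mul_le_young {Q b : ℝ} (hb : 0 ≤ b) :
    |Q| * b ≤ 2 / 3 * |Q| ^ (3 / 2 : ℝ) + 1 / 3 * b ^ 3 := by
  have hpq : (3 / 2 : ℝ).HolderConjugate 3 := by
    rw [Real.holderConjugate_iff]
    norm_num
  have h := Real.young_inequality |Q| b hpq
  rw [abs_abs, abs_of_nonneg hb] at h
  have e : b ^ (3 : ℝ) = b ^ 3 := by exact_mod_cast Real.rpow_natCast b 3
  rw [e] at h
  linarith

/-! ### Conversions from `L³` / `L^{3/2}` bounds -/

/-- `3/2 ≠ ∞` in `ℝ≥0∞`. [folklore] -/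
private theorem three_halves_ne_top : (3 / 2 : ℝ≥0∞) ≠ ⊤ :=
  ENNReal.div_ne_top (by norm_num) (by norm_num)

/-- `1 ≤ 3/2` in `ℝ≥0∞`. [folklore] -/
private theorem one_le_three_halves : (1 : ℝ≥0∞) ≤ 3 / 2 :=
  ((ENNReal.lt_div_iff_mul_lt (Or.inl (by norm_num)) (Or.inl (by norm_num))).2 (by norm_num)).le

/-- `∫ |Q|^{3/2} ≤ P^{3/2}` when `Q ∈ L^{3/2}` with `‖Q‖_{L^{3/2}} ≤ P`. [folklore] -/
theorem integral_abs_rpow_le {Q : EuclideanSpace ℝ (Fin 3) → ℝ}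
    (hQ : MemLp Q (3 / 2 : ℝ≥0∞) volume) {P : ℝ}
    (hP : (eLpNorm Q (3 / 2 : ℝ≥0∞) volume).toReal ≤ P) :
    ∫ x, |Q x| ^ (3 / 2 : ℝ) ≤ P ^ (3 / 2 : ℝ) := by
  have h := hQ.eLpNorm_eq_integral_rpow_norm (by norm_num) three_halves_ne_top
  have h32 : (3 / 2 : ℝ≥0∞).toReal = 3 / 2 := by
    rw [ENNReal.toReal_div]; norm_num
  rw [h32] at h
  simp only [Real.norm_eq_abs] at h
  set I : ℝ := ∫ x, |Q x| ^ (3 / 2 : ℝ) with hI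
  have hI0 : 0 ≤ I := integral_nonneg fun x => by positivity
  have h1 : I ^ (3 / 2 : ℝ)⁻¹ ≤ P := by
    rw [h, ENNReal.toReal_ofReal (Real.rpow_nonneg hI0 _)] at hP
    exact hP
  have hP0 : 0 ≤ P := (Real.rpow_nonneg hI0 _).trans h1
  calc I = (I ^ (3 / 2 : ℝ)⁻¹) ^ (3 / 2 : ℝ) := (Real.rpow_inv_rpow hI0 (by norm_num)).symm
    _ ≤ P ^ (3 / 2 : ℝ) := Real.rpow_le_rpow (Real.rpow_nonneg hI0 _) h1 (by norm_num)

/-! ### The pressure constant drops out -/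

variable {ν : ℝ} {u : ℝ → EuclideanSpace ℝ (Fin 3) → EuclideanSpace ℝ (Fin 3)}
  {p : ℝ → EuclideanSpace ℝ (Fin 3) → ℝ}

/-- **The cut-off pressure pairing only sees the Riesz pressure.** If `p(τ) = Π + C` a.e. with
`Π` locally integrable, then for a smooth compactly supported `χ` and a `C¹` divergence-free `ψ`,
`∫ p(τ, x) Dχ(x)(ψ x) dx = ∫ Π(x) Dχ(x)(ψ x) dx`. [folklore] -/
theorem integral_pressure_mul_fderiv_apply_eq {pτ Q : EuclideanSpace ℝ (Fin 3) → ℝ} {C : ℝ}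
    (hQ : LocallyIntegrable Q volume)
    (hae : ∀ᵐ x ∂(volume : Measure (EuclideanSpace ℝ (Fin 3))), pτ x = Q x + C)
    {χ : EuclideanSpace ℝ (Fin 3) → ℝ} (hχ : ContDiff ℝ 1 χ) (hχc : HasCompactSupport χ)
    {ψ : EuclideanSpace ℝ (Fin 3) → EuclideanSpace ℝ (Fin 3)} (hψ : ContDiff ℝ 1 ψ)
    (hdiv : VectorCalculus.IsDivFree ψ) :
    ∫ x, pτ x * fderiv ℝ χ x (ψ x) = ∫ x, Q x * fderiv ℝ χ x (ψ x) := by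
  -- the kernel `k = Dχ(ψ)` is continuous with compact support
  set k : EuclideanSpace ℝ (Fin 3) → ℝ := fun x => fderiv ℝ χ x (ψ x) with hk
  have hkc : Continuous k := (hχ.continuous_fderiv one_ne_zero).clm_apply hψ.continuous
  have hks : HasCompactSupport k := (hχc.fderiv (𝕜 := ℝ)).mono fun x hx => by
    contrapose! hx
    simp only [mem_support, not_not] at hx
    simp [hk, hx]
  have hK : IsCompact (tsupport k) := hks
  have iQ : Integrable fun x => Q x * k x := by
    have hon : IntegrableOn (fun x => Q x * k x) (tsupport k) :=
      (hQ.integrableOn_isCompact hK).mul_continuousOn hkc.continuousOn hK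
    exact (integrableOn_iff_integrable_of_support_subset
      ((support_mul_subset_right _ _).trans (subset_tsupport _))).1 hon
  have iC : Integrable fun x => C * k x := (hkc.integrable_of_hasCompactSupport hks).const_mul C
  have e1 : ∫ x, pτ x * k x = ∫ x, (Q x * k x + C * k x) := by
    refine integral_congr_ae ?_
    filter_upwards [hae] with x hx
    rw [hx, add_mul]
  rw [e1, integral_add iQ iC, integral_const_mul,
    integral_fderiv_apply_eq_zero_of_isDivFree hψ hdiv hχ hχc, mul_zero, add_zero]

/-! ### The duality identity -/

-- one long dominated-convergence bookkeeping proof (four cut-off terms, two limits)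
set_option maxHeartbeats 1600000 in
/-- **Classical solutions with `L³` slices satisfy the duality identity** (Fabes–Jones–Rivière
1972, Thm. 2.1 (i), in `L³`; Kato 1984, (1.7)). Let `(u, p)` be a classical solution of the
unforced Navier–Stokes system with `ν > 0` on `(t₁, t₂)`, `t₁ < 0`, with `u(s) ∈ L³` and
`‖u(s)‖_{L³} ≤ M` for `s ∈ (t₁, t₂)`. Then for `0 ≤ t < t₂` and every smooth compactly supported
divergence-free `φ`:
`∫⟪u t, φ⟫ = ∫⟪u 0, e^{νtΔ}φ⟫ + ∫₀ᵗ ∫⟪u τ, (u τ·∇) e^{ν(t-τ)Δ}φ⟫ dτ` (`IsMildNSSolutionFrom`). [cite: FabesJonesRiviere1972, Thm. 2.1 (i)] -/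
theorem isMildNSSolutionFrom_of_memLp_three {t₁ t₂ : ℝ}
    (h : IsClassicalNSSolutionOn (Ioo t₁ t₂) ν 0 u p) (hν : 0 < ν) (ht₁ : t₁ < 0)
    (h3 : ∀ s ∈ Ioo t₁ t₂, MemLp (u s) 3 volume) {M : ℝ≥0}
    (hM : ∀ s ∈ Ioo t₁ t₂, eLpNorm (u s) 3 volume ≤ M) {t : ℝ} (ht0 : 0 ≤ t) (ht₂ : t < t₂) :
    IsMildNSSolutionFrom ν 0 (u 0) u t := by
  intro φ hφ hdiv
  rcases ht0.eq_or_lt with h0 | ht0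
  · subst h0
    simp
  -- genuine case `0 < t < t₂`: restrict to `[0, t]`
  set S₀ : Set ℝ := Icc 0 t with hS₀
  have hU : UniqueDiffOn ℝ S₀ := uniqueDiffOn_Icc ht0
  have hS₀sub : S₀ ⊆ Ioo t₁ t₂ := fun s hs => ⟨ht₁.trans_le hs.1, hs.2.trans_lt ht₂⟩
  have h₀ : IsClassicalNSSolutionOn S₀ ν 0 u p := h.mono hS₀sub hU
  have hIt : Icc 0 t ⊆ S₀ := Subset.rfl
  have h0S : (0 : ℝ) ∈ S₀ := ⟨le_rfl, ht0.le⟩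
  set b := stdOrthonormalBasis ℝ (EuclideanSpace ℝ (Fin 3)) with hb
  have hcard : (Fintype.card (Fin 3) : ℝ) = 3 := by simp
  -- the `L³` data along the flow
  have hN : ∀ s ∈ S₀, ∫ y, ‖u s y‖ ^ 3 ≤ (M : ℝ) ^ 3 := fun s hs =>
    PressureNormalisationL3.integral_norm_pow_three_le (h3 s (hS₀sub hs)) (hM s (hS₀sub hs))
  have hu3i : ∀ s ∈ S₀, Integrable (fun y => ‖u s y‖ ^ 3) volume := fun s hs =>
    (h3 s (hS₀sub hs)).integrable_norm_pow three_ne_zero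
  set P : ℝ := steinConstThreeHalves * (M : ℝ) ^ 2 with hP
  have hP0 : 0 ≤ P := by positivity
  have hQ : ∀ s ∈ S₀, MemLp (rieszPressure (u s)) (3 / 2 : ℝ≥0∞) volume := fun s hs =>
    memLp_rieszPressure (h3 s (hS₀sub hs))
  have hQP : ∀ s ∈ S₀, ∫ y, |rieszPressure (u s) y| ^ (3 / 2 : ℝ) ≤ P ^ (3 / 2 : ℝ) := fun s hs =>
    integral_abs_rpow_le (hQ s hs)
      (PressureNormalisationL3.toReal_eLpNorm_rieszPressure_le (h3 s (hS₀sub hs)) (hM s (hS₀sub hs)))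
  have hQi : ∀ s ∈ S₀, Integrable (fun y => |rieszPressure (u s) y| ^ (3 / 2 : ℝ)) volume := by
    intro s hs
    have h1 := (hQ s hs).integrable_norm_rpow (by norm_num) three_halves_ne_top
    have h32 : (3 / 2 : ℝ≥0∞).toReal = 3 / 2 := by rw [ENNReal.toReal_div]; norm_num
    simpa only [h32, Real.norm_eq_abs] using h1
  -- the pressure normalisation
  have hnorm : ∀ s ∈ S₀, ∃ C : ℝ, ∀ᵐ y ∂(volume : Measure (EuclideanSpace ℝ (Fin 3))),
      p s y = rieszPressure (u s) y + C := fun s hs =>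
    PressureNormalisationL3.pressure_ae_eq_rieszPressure_add_const hν.le h h3 hM (hS₀sub hs)
  -- cut-off constants
  obtain ⟨C₁, hC₁0, hC₁⟩ := exists_norm_fderiv_cutoff_le (E := EuclideanSpace ℝ (Fin 3))
  obtain ⟨C₂, hC₂0, hC₂⟩ := exists_abs_laplacian_cutoff_le (E := EuclideanSpace ℝ (Fin 3))
  have hR : ∀ n : ℕ, (0 : ℝ) < n + 1 := fun n => by positivity
  have hR1 : ∀ n : ℕ, (1 : ℝ) ≤ n + 1 := fun n => by
    have : (0 : ℝ) ≤ n := n.cast_nonneg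
    linarith
  have hDχ : ∀ (n : ℕ) (x : EuclideanSpace ℝ (Fin 3)),
      ‖fderiv ℝ (cutoff ((n : ℝ) + 1)) x‖ ≤ C₁ := fun n x =>
    (hC₁ _ (hR n) x).trans (div_le_self hC₁0 (hR1 n))
  have hΔχ : ∀ (n : ℕ) (x : EuclideanSpace ℝ (Fin 3)),
      |(Δ (cutoff ((n : ℝ) + 1) : EuclideanSpace ℝ (Fin 3) → ℝ)) x| ≤ C₂ := fun n x =>
    (hC₂ _ (hR n) x).trans (div_le_self hC₂0 (by nlinarith [hR1 n]))
  -- the test field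
  have hφi : ContDiff ℝ ∞ φ := hφ.contDiff
  have hφ2 : ContDiff ℝ 2 φ := contDiff_infty.1 hφi 2
  have hφ1 : ContDiff ℝ 1 φ := contDiff_infty.1 hφi 1
  have hφc : HasCompactSupport φ := hφ.hasCompactSupport
  have hφc' : Continuous φ := hφi.continuous
  obtain ⟨Cφ, hCφ⟩ := hφc'.bounded_above_of_compact_support hφc
  have hCφ0 : 0 ≤ Cφ := (norm_nonneg _).trans (hCφ 0)
  have hDφc : Continuous (fderiv ℝ φ) := hφ1.continuous_fderiv one_ne_zero
  have hDφs : HasCompactSupport (fderiv ℝ φ) := hφc.fderiv ℝ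
  obtain ⟨CD, hCD⟩ := hDφc.bounded_above_of_compact_support hDφs
  have hCD0 : 0 ≤ CD := (norm_nonneg _).trans (hCD 0)
  have hφint : Integrable φ (volume : Measure (EuclideanSpace ℝ (Fin 3))) :=
    hφc'.integrable_of_hasCompactSupport hφc
  have hDφint : Integrable (fderiv ℝ φ) (volume : Measure (EuclideanSpace ℝ (Fin 3))) :=
    hDφc.integrable_of_hasCompactSupport hDφs
  -- the caloric test field `Ψ τ = e^{ν(t-τ)Δ} φ`
  set Ψ : ℝ → EuclideanSpace ℝ (Fin 3) → EuclideanSpace ℝ (Fin 3) := fun τ => heatTest ν φ (t - τ)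
    with hΨ
  have hΨsm : ∀ τ, ContDiff ℝ 2 (Ψ τ) := fun τ => contDiff_heatFlow hφ2 hφc _
  have hΨ1 : ∀ τ, ContDiff ℝ 1 (Ψ τ) := fun τ => (hΨsm τ).of_le one_le_two
  have hΨcs : ∀ τ, Continuous (Ψ τ) := fun τ => (hΨsm τ).continuous
  have hΨdiv : ∀ τ, VectorCalculus.IsDivFree (Ψ τ) := fun τ => isDivFree_heatFlow hφ1 hφc hdiv _
  have hDΨ : ∀ τ x, fderiv ℝ (Ψ τ) x = heatFlow (fderiv ℝ φ) (ν * (t - τ)) x := fun τ x =>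
    fderiv_heatFlow hφ1 hφc _ x
  have hΨc : Continuous (uncurry Ψ) := continuous_uncurry_heatTest_sub hφc' hCφ ν t
  have hDΨc : Continuous fun q : ℝ × EuclideanSpace ℝ (Fin 3) => fderiv ℝ (Ψ q.1) q.2 := by
    simp only [hDΨ]
    exact continuous_uncurry_heatTest_sub hDφc hCD ν t
  have hDΨcs : ∀ τ, Continuous fun x => fderiv ℝ (Ψ τ) x := fun τ =>
    hDΨc.comp (Continuous.prodMk_right τ)
  have hΨint : ∀ τ, Integrable (Ψ τ) (volume : Measure (EuclideanSpace ℝ (Fin 3))) := fun τ =>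
    integrable_heatFlow hφint _
  have hDΨint : ∀ τ, Integrable (fun x => fderiv ℝ (Ψ τ) x)
      (volume : Measure (EuclideanSpace ℝ (Fin 3))) := fun τ => by
    simp only [hDΨ]
    exact integrable_heatFlow hDφint _
  have hΨL1 : ∀ τ, ∫ x, ‖Ψ τ x‖ ≤ ∫ x, ‖φ x‖ := fun τ => integral_norm_heatFlow_le hφint _
  have hDΨL1 : ∀ τ, ∫ x, ‖fderiv ℝ (Ψ τ) x‖ ≤ ∫ x, ‖fderiv ℝ φ x‖ := fun τ => by
    simp only [hDΨ]
    exact integral_norm_heatFlow_le hDφint _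
  have hΨb : ∀ τ x, ‖Ψ τ x‖ ≤ Cφ := fun τ x => norm_heatFlow_le hCφ _ x
  have hDΨb : ∀ τ x, ‖fderiv ℝ (Ψ τ) x‖ ≤ CD := fun τ x => by
    rw [hDΨ]
    exact norm_heatFlow_le hCD _ x
  -- continuity of the data on `[0, t] × ℝ³`
  have hu_cont : ContinuousOn (uncurry u) (Icc 0 t ×ˢ univ) := h₀.smooth_velocity.continuousOn
  have hp_cont : ContinuousOn (uncurry p) (Icc 0 t ×ˢ univ) := h₀.smooth_pressure.continuousOn
  have hucs : ∀ τ ∈ Icc 0 t, Continuous (u τ) := fun τ hτ =>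
    (h₀.contDiff_velocity hτ).continuous
  -- the limit integrand
  have hAc : ContinuousOn
      (fun q : ℝ × EuclideanSpace ℝ (Fin 3) => ⟪u q.1 q.2, convect (u q.1) (Ψ q.1) q.2⟫)
      (Icc 0 t ×ˢ univ) := hu_cont.inner (hDΨc.continuousOn.clm_apply hu_cont)
  -- pointwise AM–GM bounds for the velocity pairings
  have hAb : ∀ τ x, |⟪u τ x, convect (u τ) (Ψ τ) x⟫| ≤
      2 / 3 * ‖u τ x‖ ^ 3 + 1 / 3 * CD ^ 2 * ‖fderiv ℝ (Ψ τ) x‖ := by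
    intro τ x
    calc |⟪u τ x, convect (u τ) (Ψ τ) x⟫| ≤ ‖u τ x‖ * ‖fderiv ℝ (Ψ τ) x (u τ x)‖ :=
          abs_real_inner_le_norm _ _
      _ ≤ ‖u τ x‖ * (‖fderiv ℝ (Ψ τ) x‖ * ‖u τ x‖) :=
          mul_le_mul_of_nonneg_left (ContinuousLinearMap.le_opNorm _ _) (norm_nonneg _)
      _ = ‖u τ x‖ ^ 2 * ‖fderiv ℝ (Ψ τ) x‖ := by ring
      _ ≤ 2 / 3 * ‖u τ x‖ ^ 3 + 1 / 3 * ‖fderiv ℝ (Ψ τ) x‖ ^ 3 :=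
          sq_mul_le (norm_nonneg _) (norm_nonneg _)
      _ ≤ 2 / 3 * ‖u τ x‖ ^ 3 + 1 / 3 * (CD ^ 2 * ‖fderiv ℝ (Ψ τ) x‖) := by
          gcongr
          exact pow_three_le (norm_nonneg _) (hDΨb τ x)
      _ = _ := by ring
  have iA : ∀ τ ∈ Icc 0 t, Integrable (fun x => ⟪u τ x, convect (u τ) (Ψ τ) x⟫)
      (volume : Measure (EuclideanSpace ℝ (Fin 3))) := fun τ hτ =>
    Integrable.mono' (((hu3i τ hτ).const_mul _).add ((hDΨint τ).norm.const_mul _))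
      ((hucs τ hτ).inner ((hDΨcs τ).clm_apply (hucs τ hτ))).aestronglyMeasurable
      (Eventually.of_forall fun x => by rw [Real.norm_eq_abs]; exact hAb τ x)
  -- the cut-off integrands `F n` (with the given pressure), `F' n` (with the Riesz pressure)
  -- and their limit `Fl`
  set F : ℕ → ℝ → EuclideanSpace ℝ (Fin 3) → ℝ := fun n τ x =>
    cutoff ((n : ℝ) + 1) x * (⟪u τ x, convect (u τ) (Ψ τ) x⟫ +
        ⟪(0 : ℝ → EuclideanSpace ℝ (Fin 3) → EuclideanSpace ℝ (Fin 3)) τ x, Ψ τ x⟫) +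
      fderiv ℝ (cutoff ((n : ℝ) + 1)) x (u τ x) * ⟪u τ x, Ψ τ x⟫ +
      ν * (2 * ∑ i, fderiv ℝ (cutoff ((n : ℝ) + 1)) x (b i) *
        ⟪u τ x, fderiv ℝ (Ψ τ) x (b i)⟫ +
        (Δ (cutoff ((n : ℝ) + 1) : EuclideanSpace ℝ (Fin 3) → ℝ)) x * ⟪u τ x, Ψ τ x⟫) +
      p τ x * fderiv ℝ (cutoff ((n : ℝ) + 1)) x (Ψ τ x) with hF
  set V : ℕ → ℝ → EuclideanSpace ℝ (Fin 3) → ℝ := fun n τ x =>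
    cutoff ((n : ℝ) + 1) x * ⟪u τ x, convect (u τ) (Ψ τ) x⟫ +
      fderiv ℝ (cutoff ((n : ℝ) + 1)) x (u τ x) * ⟪u τ x, Ψ τ x⟫ +
      ν * (2 * ∑ i, fderiv ℝ (cutoff ((n : ℝ) + 1)) x (b i) *
        ⟪u τ x, fderiv ℝ (Ψ τ) x (b i)⟫ +
        (Δ (cutoff ((n : ℝ) + 1) : EuclideanSpace ℝ (Fin 3) → ℝ)) x * ⟪u τ x, Ψ τ x⟫) with hV
  set F' : ℕ → ℝ → EuclideanSpace ℝ (Fin 3) → ℝ := fun n τ x =>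
    V n τ x + rieszPressure (u τ) x * fderiv ℝ (cutoff ((n : ℝ) + 1)) x (Ψ τ x) with hF'
  set Fl : ℝ → EuclideanSpace ℝ (Fin 3) → ℝ := fun τ x => ⟪u τ x, convect (u τ) (Ψ τ) x⟫ with hFl
  have hFV : ∀ n τ x, F n τ x = V n τ x + p τ x * fderiv ℝ (cutoff ((n : ℝ) + 1)) x (Ψ τ x) := by
    intro n τ x
    simp only [hF, hV, Pi.zero_apply, inner_zero_left, add_zero]
  -- (i) the identity for each `n`
  have hident : ∀ n : ℕ, (∫ x, cutoff ((n : ℝ) + 1) x * ⟪u t x, φ x⟫) -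
      ∫ x, cutoff ((n : ℝ) + 1) x * ⟪u 0 x, heatTest ν φ t x⟫ = ∫ τ in 0..t, ∫ x, F n τ x := by
    intro n
    have h1 := h₀.cutoff_duality_ftc hν ht0 le_rfl hφi hφc (contDiff_cutoff _)
      (hasCompactSupport_cutoff (hR n))
    have h2 : EqOn (fun τ => ∫ x, (⟪timeDerivWithin S₀ u τ x, cutoff ((n : ℝ) + 1) x • Ψ τ x⟫ -
        ν * (cutoff ((n : ℝ) + 1) x * ⟪u τ x, (Δ (Ψ τ)) x⟫))) (fun τ => ∫ x, F n τ x)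
        (uIcc 0 t) := by
      intro τ hτ
      rw [uIcc_of_le ht0.le] at hτ
      exact h₀.integral_duality_slice_eq hU (hIt hτ) (hΨsm τ) (hΨdiv τ) (contDiff_cutoff _)
        (hasCompactSupport_cutoff (hR n))
    have h3 := intervalIntegral.integral_congr (μ := volume) h2
    have hL : (∫ x, cutoff ((n : ℝ) + 1) x * ⟪u t x, φ x⟫) -
        ∫ x, cutoff ((n : ℝ) + 1) x * ⟪u 0 x, heatTest ν φ t x⟫ =
        (∫ x, ⟪u t x, cutoff ((n : ℝ) + 1) x • φ x⟫) -
          ∫ x, ⟪u 0 x, cutoff ((n : ℝ) + 1) x • heatTest ν φ t x⟫ := by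
      simp only [real_inner_smul_right]
    exact (hL.trans h1).trans h3
  -- (ii) joint continuity and compact support of `F n`
  have hVc : ∀ n, ContinuousOn (uncurry (V n)) (Icc 0 t ×ˢ univ) := by
    intro n
    have hχ : ContDiff ℝ 2 (cutoff ((n : ℝ) + 1) : EuclideanSpace ℝ (Fin 3) → ℝ) := contDiff_cutoff _
    have c1 : Continuous (cutoff ((n : ℝ) + 1) : EuclideanSpace ℝ (Fin 3) → ℝ) := hχ.continuous
    have c2 : Continuous (fderiv ℝ (cutoff ((n : ℝ) + 1) : EuclideanSpace ℝ (Fin 3) → ℝ)) :=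
      (hχ.of_le one_le_two).continuous_fderiv one_ne_zero
    have c3 : Continuous (Δ (cutoff ((n : ℝ) + 1) : EuclideanSpace ℝ (Fin 3) → ℝ)) :=
      FluidPDE.continuous_laplacian hχ
    have huΨ : ContinuousOn (fun q : ℝ × EuclideanSpace ℝ (Fin 3) => ⟪u q.1 q.2, Ψ q.1 q.2⟫)
        (Icc 0 t ×ˢ univ) := hu_cont.inner hΨc.continuousOn
    have T1 : ContinuousOn (fun q : ℝ × EuclideanSpace ℝ (Fin 3) => cutoff ((n : ℝ) + 1) q.2 *
        ⟪u q.1 q.2, convect (u q.1) (Ψ q.1) q.2⟫) (Icc 0 t ×ˢ univ) :=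
      (c1.comp continuous_snd).continuousOn.mul hAc
    have T2 : ContinuousOn (fun q : ℝ × EuclideanSpace ℝ (Fin 3) =>
        fderiv ℝ (cutoff ((n : ℝ) + 1)) q.2 (u q.1 q.2) * ⟪u q.1 q.2, Ψ q.1 q.2⟫) (Icc 0 t ×ˢ univ) :=
      ((c2.comp continuous_snd).continuousOn.clm_apply hu_cont).mul huΨ
    have T3 : ContinuousOn (fun q : ℝ × EuclideanSpace ℝ (Fin 3) => ν * (2 * ∑ i,
        fderiv ℝ (cutoff ((n : ℝ) + 1)) q.2 (b i) * ⟪u q.1 q.2, fderiv ℝ (Ψ q.1) q.2 (b i)⟫ +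
        (Δ (cutoff ((n : ℝ) + 1) : EuclideanSpace ℝ (Fin 3) → ℝ)) q.2 * ⟪u q.1 q.2, Ψ q.1 q.2⟫))
        (Icc 0 t ×ˢ univ) := by
      refine continuousOn_const.mul ((continuousOn_const.mul (continuousOn_finsetSum _
        fun i _ => ?_)).add ((c3.comp continuous_snd).continuousOn.mul huΨ))
      exact ((c2.comp continuous_snd).clm_apply continuous_const).continuousOn.mul
        (hu_cont.inner (hDΨc.continuousOn.clm_apply continuousOn_const))
    exact (T1.add T2).add T3
  have hFc : ∀ n, ContinuousOn (uncurry (F n)) (Icc 0 t ×ˢ univ) := by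
    intro n
    have hχ : ContDiff ℝ 2 (cutoff ((n : ℝ) + 1) : EuclideanSpace ℝ (Fin 3) → ℝ) := contDiff_cutoff _
    have c2 : Continuous (fderiv ℝ (cutoff ((n : ℝ) + 1) : EuclideanSpace ℝ (Fin 3) → ℝ)) :=
      (hχ.of_le one_le_two).continuous_fderiv one_ne_zero
    have T4 : ContinuousOn (fun q : ℝ × EuclideanSpace ℝ (Fin 3) => p q.1 q.2 *
        fderiv ℝ (cutoff ((n : ℝ) + 1)) q.2 (Ψ q.1 q.2)) (Icc 0 t ×ˢ univ) :=
      hp_cont.mul ((c2.comp continuous_snd).continuousOn.clm_apply hΨc.continuousOn)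
    have e : uncurry (F n) = fun q : ℝ × EuclideanSpace ℝ (Fin 3) =>
        uncurry (V n) q + p q.1 q.2 * fderiv ℝ (cutoff ((n : ℝ) + 1)) q.2 (Ψ q.1 q.2) := by
      funext q
      exact hFV n q.1 q.2
    rw [e]
    exact (hVc n).add T4
  have hFK : ∀ (n : ℕ) (τ : ℝ), ∀ x ∉ closedBall (0 : EuclideanSpace ℝ (Fin 3)) (2 * ((n : ℝ) + 1)),
      F n τ x = 0 := by
    intro n τ x hx
    have hx' : x ∉ tsupport (cutoff ((n : ℝ) + 1) : EuclideanSpace ℝ (Fin 3) → ℝ) := fun h' =>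
      hx (tsupport_cutoff_subset (hR n) h')
    simp [hF, image_eq_zero_of_notMem_tsupport hx', fderiv_of_notMem_tsupport ℝ hx',
      FluidPDE.laplacian_eq_zero_of_notMem_tsupport hx']
  have hFcs : ∀ n, ∀ τ ∈ Icc 0 t, Continuous (F n τ) := by
    intro n τ hτ
    have := (hFc n).comp_continuous (Continuous.prodMk_right τ) fun x => ⟨hτ, mem_univ x⟩
    simpa [Function.comp_def] using this
  have hVcs : ∀ n, ∀ τ ∈ Icc 0 t, Continuous (V n τ) := by
    intro n τ hτ
    have := (hVc n).comp_continuous (Continuous.prodMk_right τ) fun x => ⟨hτ, mem_univ x⟩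
    simpa [Function.comp_def] using this
  have hGc : ∀ n, ContinuousOn (fun τ => ∫ x, F n τ x) (Icc 0 t) := fun n =>
    continuousOn_integral_of_support_subset (μ := volume) (isCompact_closedBall 0 _) (hFc n)
      fun τ _ x hx => hFK n τ x hx
  have hFi : ∀ n, ∀ τ ∈ Icc 0 t, Integrable (F n τ) (volume : Measure (EuclideanSpace ℝ (Fin 3))) :=
    fun n τ hτ => (hFcs n τ hτ).integrable_of_hasCompactSupport
      (HasCompactSupport.intro (isCompact_closedBall 0 _) (hFK n τ))
  -- (iii) swapping the pressure for the Riesz pressure inside the integral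
  have hswap : ∀ n, ∀ τ ∈ Icc 0 t, ∫ x, F n τ x = ∫ x, F' n τ x := by
    intro n τ hτ
    obtain ⟨C, hC⟩ := hnorm τ hτ
    have hVK : ∀ x ∉ closedBall (0 : EuclideanSpace ℝ (Fin 3)) (2 * ((n : ℝ) + 1)), V n τ x = 0 := by
      intro x hx
      have hx' : x ∉ tsupport (cutoff ((n : ℝ) + 1) : EuclideanSpace ℝ (Fin 3) → ℝ) := fun h' =>
        hx (tsupport_cutoff_subset (hR n) h')
      simp [hV, image_eq_zero_of_notMem_tsupport hx', fderiv_of_notMem_tsupport ℝ hx',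
        FluidPDE.laplacian_eq_zero_of_notMem_tsupport hx']
    have hVi : Integrable (V n τ) (volume : Measure (EuclideanSpace ℝ (Fin 3))) :=
      (hVcs n τ hτ).integrable_of_hasCompactSupport
        (HasCompactSupport.intro (isCompact_closedBall 0 _) hVK)
    have hPterm := integral_pressure_mul_fderiv_apply_eq
      ((hQ τ hτ).locallyIntegrable one_le_three_halves) hC
      (contDiff_cutoff (n := 1) _) (hasCompactSupport_cutoff (hR n)) (hΨ1 τ) (hΨdiv τ)
    have iP : Integrable (fun x => p τ x * fderiv ℝ (cutoff ((n : ℝ) + 1)) x (Ψ τ x)) := by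
      have e : (fun x => p τ x * fderiv ℝ (cutoff ((n : ℝ) + 1)) x (Ψ τ x)) =
          fun x => F n τ x - V n τ x := by
        funext x; rw [hFV n τ x]; ring
      rw [e]
      exact (hFi n τ hτ).sub hVi
    have iQ : Integrable (fun x => rieszPressure (u τ) x * fderiv ℝ (cutoff ((n : ℝ) + 1)) x (Ψ τ x)) := by
      -- `Π ∈ L¹_loc` against the continuous compactly supported kernel
      set k : EuclideanSpace ℝ (Fin 3) → ℝ := fun x => fderiv ℝ (cutoff ((n : ℝ) + 1)) x (Ψ τ x)
        with hk
      have hkc : Continuous k :=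
        (((contDiff_cutoff (n := 1) _).continuous_fderiv one_ne_zero).clm_apply (hΨcs τ))
      have hks : HasCompactSupport k := ((hasCompactSupport_cutoff (hR n)).fderiv (𝕜 := ℝ)).mono
        fun x hx => by
          contrapose! hx
          simp only [mem_support, not_not] at hx
          simp [hk, hx]
      have hK : IsCompact (tsupport k) := hks
      have hon : IntegrableOn (fun x => rieszPressure (u τ) x * k x) (tsupport k) :=
        (((hQ τ hτ).locallyIntegrable one_le_three_halves).integrableOn_isCompact hK)
          |>.mul_continuousOn hkc.continuousOn hK
      exact (integrableOn_iff_integrable_of_support_subset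
        ((support_mul_subset_right _ _).trans (subset_tsupport _))).1 hon
    calc ∫ x, F n τ x = ∫ x, (V n τ x + p τ x * fderiv ℝ (cutoff ((n : ℝ) + 1)) x (Ψ τ x)) :=
          integral_congr_ae (Eventually.of_forall (hFV n τ))
      _ = (∫ x, V n τ x) + ∫ x, p τ x * fderiv ℝ (cutoff ((n : ℝ) + 1)) x (Ψ τ x) :=
          integral_add hVi iP
      _ = (∫ x, V n τ x) + ∫ x, rieszPressure (u τ) x * fderiv ℝ (cutoff ((n : ℝ) + 1)) x (Ψ τ x) := by
          rw [hPterm]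
      _ = ∫ x, F' n τ x := (integral_add hVi iQ).symm
  -- (iv) the dominating function for `F' n`
  set A₁ : ℝ := 2 / 3 + 2 / 3 * C₁ + ν * (2 * 3 * C₁ / 3 + C₂ / 3) with hA₁
  set A₂ : ℝ := 1 / 3 * C₁ * Cφ ^ 2 + ν * C₂ * (2 / 3 * Real.sqrt Cφ) + 1 / 3 * C₁ ^ 3 * Cφ ^ 2
    with hA₂
  set A₃ : ℝ := 1 / 3 * CD ^ 2 + ν * 2 * 3 * C₁ * (2 / 3 * Real.sqrt CD) with hA₃
  set A₄ : ℝ := 2 / 3 with hA₄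
  have hA₁0 : 0 ≤ A₁ := by rw [hA₁]; positivity
  have hA₂0 : 0 ≤ A₂ := by rw [hA₂]; positivity
  have hA₃0 : 0 ≤ A₃ := by rw [hA₃]; positivity
  have hA₄0 : 0 ≤ A₄ := by rw [hA₄]; positivity
  set G : ℝ → EuclideanSpace ℝ (Fin 3) → ℝ := fun τ x =>
    A₁ * ‖u τ x‖ ^ 3 + A₂ * ‖Ψ τ x‖ + A₃ * ‖fderiv ℝ (Ψ τ) x‖ +
      A₄ * |rieszPressure (u τ) x| ^ (3 / 2 : ℝ) with hG
  have hbound : ∀ n τ x, ‖F' n τ x‖ ≤ G τ x := by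
    intro n τ x
    have b4 : |cutoff ((n : ℝ) + 1) x| ≤ 1 := abs_cutoff_le_one _ _
    have b5 : ‖fderiv ℝ (cutoff ((n : ℝ) + 1)) x‖ ≤ C₁ := hDχ n x
    have b6 : |(Δ (cutoff ((n : ℝ) + 1) : EuclideanSpace ℝ (Fin 3) → ℝ)) x| ≤ C₂ := hΔχ n x
    have hlin : ∀ v : EuclideanSpace ℝ (Fin 3),
        |fderiv ℝ (cutoff ((n : ℝ) + 1)) x v| ≤ C₁ * ‖v‖ := fun v => by
      rw [← Real.norm_eq_abs]
      exact (ContinuousLinearMap.le_opNorm _ _).trans (mul_le_mul_of_nonneg_right b5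
        (norm_nonneg _))
    -- the elementary AM–GM estimates
    have am1 : ‖u τ x‖ ^ 2 * ‖Ψ τ x‖ ≤ 2 / 3 * ‖u τ x‖ ^ 3 + 1 / 3 * (Cφ ^ 2 * ‖Ψ τ x‖) :=
      (sq_mul_le (norm_nonneg _) (norm_nonneg _)).trans (by
        gcongr; exact pow_three_le (norm_nonneg _) (hΨb τ x))
    have am2 : ‖u τ x‖ * ‖fderiv ℝ (Ψ τ) x‖ ≤
        ‖u τ x‖ ^ 3 / 3 + 2 / 3 * Real.sqrt CD * ‖fderiv ℝ (Ψ τ) x‖ :=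
      mul_le_of_le_sq (norm_nonneg _) (norm_nonneg _) (Real.sqrt_nonneg _)
        (by rw [Real.sq_sqrt hCD0]; exact hDΨb τ x)
    have am3 : ‖u τ x‖ * ‖Ψ τ x‖ ≤ ‖u τ x‖ ^ 3 / 3 + 2 / 3 * Real.sqrt Cφ * ‖Ψ τ x‖ :=
      mul_le_of_le_sq (norm_nonneg _) (norm_nonneg _) (Real.sqrt_nonneg _)
        (by rw [Real.sq_sqrt hCφ0]; exact hΨb τ x)
    have am4 : |rieszPressure (u τ) x| * (C₁ * ‖Ψ τ x‖) ≤
        2 / 3 * |rieszPressure (u τ) x| ^ (3 / 2 : ℝ) + 1 / 3 * (C₁ ^ 3 * Cφ ^ 2 * ‖Ψ τ x‖) := by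
      refine (abs_mul_le_young (by positivity)).trans ?_
      gcongr
      have h1 : C₁ * ‖Ψ τ x‖ ≤ C₁ * Cφ := mul_le_mul_of_nonneg_left (hΨb τ x) hC₁0
      calc (C₁ * ‖Ψ τ x‖) ^ 3 ≤ (C₁ * Cφ) ^ 2 * (C₁ * ‖Ψ τ x‖) := pow_three_le (by positivity) h1
        _ = C₁ ^ 3 * Cφ ^ 2 * ‖Ψ τ x‖ := by ring
    -- term 1
    have hT1 : |cutoff ((n : ℝ) + 1) x * ⟪u τ x, convect (u τ) (Ψ τ) x⟫| ≤
        1 * (2 / 3 * ‖u τ x‖ ^ 3 + 1 / 3 * CD ^ 2 * ‖fderiv ℝ (Ψ τ) x‖) := by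
      rw [abs_mul]
      exact mul_le_mul b4 (hAb τ x) (abs_nonneg _) zero_le_one
    -- term 2
    have hT2 : |fderiv ℝ (cutoff ((n : ℝ) + 1)) x (u τ x) * ⟪u τ x, Ψ τ x⟫| ≤
        C₁ * (2 / 3 * ‖u τ x‖ ^ 3 + 1 / 3 * (Cφ ^ 2 * ‖Ψ τ x‖)) := by
      rw [abs_mul]
      calc |fderiv ℝ (cutoff ((n : ℝ) + 1)) x (u τ x)| * |⟪u τ x, Ψ τ x⟫|
          ≤ (C₁ * ‖u τ x‖) * (‖u τ x‖ * ‖Ψ τ x‖) :=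
            mul_le_mul (hlin _) (abs_real_inner_le_norm _ _) (abs_nonneg _) (by positivity)
        _ = C₁ * (‖u τ x‖ ^ 2 * ‖Ψ τ x‖) := by ring
        _ ≤ C₁ * (2 / 3 * ‖u τ x‖ ^ 3 + 1 / 3 * (Cφ ^ 2 * ‖Ψ τ x‖)) :=
            mul_le_mul_of_nonneg_left am1 hC₁0
    -- term 3
    have e5 : ∀ i, |fderiv ℝ (cutoff ((n : ℝ) + 1)) x (b i) *
        ⟪u τ x, fderiv ℝ (Ψ τ) x (b i)⟫| ≤ C₁ * (‖u τ x‖ * ‖fderiv ℝ (Ψ τ) x‖) := fun i => by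
      rw [abs_mul]
      refine mul_le_mul ?_ ?_ (abs_nonneg _) hC₁0
      · simpa [b.orthonormal.1 i] using hlin (b i)
      · refine (abs_real_inner_le_norm _ _).trans (mul_le_mul_of_nonneg_left ?_ (norm_nonneg _))
        simpa [b.orthonormal.1 i] using ContinuousLinearMap.le_opNorm (fderiv ℝ (Ψ τ) x) (b i)
    have e6 : |∑ i, fderiv ℝ (cutoff ((n : ℝ) + 1)) x (b i) * ⟪u τ x, fderiv ℝ (Ψ τ) x (b i)⟫| ≤
        3 * (C₁ * (‖u τ x‖ * ‖fderiv ℝ (Ψ τ) x‖)) := by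
      refine (Finset.abs_sum_le_sum_abs _ _).trans ?_
      refine (Finset.sum_le_sum fun i _ => e5 i).trans ?_
      simp
    have e4 : |⟪u τ x, Ψ τ x⟫| ≤ ‖u τ x‖ * ‖Ψ τ x‖ := abs_real_inner_le_norm _ _
    have hT3 : |ν * (2 * ∑ i, fderiv ℝ (cutoff ((n : ℝ) + 1)) x (b i) *
        ⟪u τ x, fderiv ℝ (Ψ τ) x (b i)⟫ +
        (Δ (cutoff ((n : ℝ) + 1) : EuclideanSpace ℝ (Fin 3) → ℝ)) x * ⟪u τ x, Ψ τ x⟫)| ≤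
        ν * (2 * (3 * (C₁ * (‖u τ x‖ ^ 3 / 3 + 2 / 3 * Real.sqrt CD * ‖fderiv ℝ (Ψ τ) x‖))) +
          C₂ * (‖u τ x‖ ^ 3 / 3 + 2 / 3 * Real.sqrt Cφ * ‖Ψ τ x‖)) := by
      rw [abs_mul, abs_of_pos hν]
      refine mul_le_mul_of_nonneg_left ((abs_add_le _ _).trans (add_le_add ?_ ?_)) hν.le
      · rw [abs_mul, abs_two]
        refine mul_le_mul_of_nonneg_left (e6.trans ?_) zero_le_two
        exact mul_le_mul_of_nonneg_left (mul_le_mul_of_nonneg_left am2 hC₁0) (by norm_num)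
      · rw [abs_mul]
        exact mul_le_mul b6 (e4.trans am3) (abs_nonneg _) hC₂0
    -- term 4
    have hT4 : |rieszPressure (u τ) x * fderiv ℝ (cutoff ((n : ℝ) + 1)) x (Ψ τ x)| ≤
        2 / 3 * |rieszPressure (u τ) x| ^ (3 / 2 : ℝ) + 1 / 3 * (C₁ ^ 3 * Cφ ^ 2 * ‖Ψ τ x‖) := by
      rw [abs_mul]
      exact (mul_le_mul_of_nonneg_left (hlin _) (abs_nonneg _)).trans am4
    rw [Real.norm_eq_abs]
    calc |F' n τ x| ≤ |cutoff ((n : ℝ) + 1) x * ⟪u τ x, convect (u τ) (Ψ τ) x⟫| +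
          |fderiv ℝ (cutoff ((n : ℝ) + 1)) x (u τ x) * ⟪u τ x, Ψ τ x⟫| +
          |ν * (2 * ∑ i, fderiv ℝ (cutoff ((n : ℝ) + 1)) x (b i) *
            ⟪u τ x, fderiv ℝ (Ψ τ) x (b i)⟫ +
            (Δ (cutoff ((n : ℝ) + 1) : EuclideanSpace ℝ (Fin 3) → ℝ)) x * ⟪u τ x, Ψ τ x⟫)| +
          |rieszPressure (u τ) x * fderiv ℝ (cutoff ((n : ℝ) + 1)) x (Ψ τ x)| :=
          (abs_add_le _ _).trans (add_le_add ((abs_add_le _ _).trans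
            (add_le_add (abs_add_le _ _) le_rfl)) le_rfl)
      _ ≤ 1 * (2 / 3 * ‖u τ x‖ ^ 3 + 1 / 3 * CD ^ 2 * ‖fderiv ℝ (Ψ τ) x‖) +
          C₁ * (2 / 3 * ‖u τ x‖ ^ 3 + 1 / 3 * (Cφ ^ 2 * ‖Ψ τ x‖)) +
          ν * (2 * (3 * (C₁ * (‖u τ x‖ ^ 3 / 3 + 2 / 3 * Real.sqrt CD * ‖fderiv ℝ (Ψ τ) x‖))) +
            C₂ * (‖u τ x‖ ^ 3 / 3 + 2 / 3 * Real.sqrt Cφ * ‖Ψ τ x‖)) +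
          (2 / 3 * |rieszPressure (u τ) x| ^ (3 / 2 : ℝ) + 1 / 3 * (C₁ ^ 3 * Cφ ^ 2 * ‖Ψ τ x‖)) :=
          add_le_add (add_le_add (add_le_add hT1 hT2) hT3) hT4
      _ = G τ x := by
          simp only [hG, hA₁, hA₂, hA₃, hA₄]
          ring
  have hGi : ∀ τ ∈ Icc 0 t, Integrable (G τ) (volume : Measure (EuclideanSpace ℝ (Fin 3))) :=
    fun τ hτ =>
    ((((hu3i τ hτ).const_mul A₁).add ((hΨint τ).norm.const_mul A₂)).add
      ((hDΨint τ).norm.const_mul A₃)).add ((hQi τ hτ).const_mul A₄)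
  set K : ℝ := A₁ * (M : ℝ) ^ 3 + A₂ * (∫ x, ‖φ x‖) + A₃ * (∫ x, ‖fderiv ℝ φ x‖) +
    A₄ * P ^ (3 / 2 : ℝ) with hK
  have hGint : ∀ τ ∈ Icc 0 t, ∫ x, G τ x ≤ K := by
    intro τ hτ
    have i1 : Integrable (fun x => A₁ * ‖u τ x‖ ^ 3) (volume : Measure (EuclideanSpace ℝ (Fin 3))) :=
      (hu3i τ hτ).const_mul A₁
    have i2 : Integrable (fun x => A₂ * ‖Ψ τ x‖) (volume : Measure (EuclideanSpace ℝ (Fin 3))) :=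
      (hΨint τ).norm.const_mul A₂
    have i3 : Integrable (fun x => A₃ * ‖fderiv ℝ (Ψ τ) x‖)
        (volume : Measure (EuclideanSpace ℝ (Fin 3))) := (hDΨint τ).norm.const_mul A₃
    have i4 : Integrable (fun x => A₄ * |rieszPressure (u τ) x| ^ (3 / 2 : ℝ))
        (volume : Measure (EuclideanSpace ℝ (Fin 3))) := (hQi τ hτ).const_mul A₄
    have i12 : Integrable (fun x => A₁ * ‖u τ x‖ ^ 3 + A₂ * ‖Ψ τ x‖)
        (volume : Measure (EuclideanSpace ℝ (Fin 3))) := i1.add i2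
    have i123 : Integrable (fun x => A₁ * ‖u τ x‖ ^ 3 + A₂ * ‖Ψ τ x‖ + A₃ * ‖fderiv ℝ (Ψ τ) x‖)
        (volume : Measure (EuclideanSpace ℝ (Fin 3))) := i12.add i3
    rw [hG]
    dsimp only
    rw [integral_add i123 i4, integral_add i12 i3, integral_add i1 i2,
      integral_const_mul, integral_const_mul, integral_const_mul, integral_const_mul, hK]
    exact add_le_add (add_le_add (add_le_add (mul_le_mul_of_nonneg_left (hN τ hτ) hA₁0)
      (mul_le_mul_of_nonneg_left (hΨL1 τ) hA₂0)) (mul_le_mul_of_nonneg_left (hDΨL1 τ) hA₃0))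
      (mul_le_mul_of_nonneg_left (hQP τ hτ) hA₄0)
  -- (v) dominated convergence in `x` at every fixed `τ ∈ [0, t]`
  have hinner : ∀ τ ∈ Icc 0 t,
      Tendsto (fun n : ℕ => ∫ x, F n τ x) atTop (𝓝 (∫ x, Fl τ x)) := by
    intro τ hτ
    have hF'm : ∀ n, AEStronglyMeasurable (F' n τ) (volume : Measure (EuclideanSpace ℝ (Fin 3))) :=
      fun n => by
      refine (hVcs n τ hτ).aestronglyMeasurable.add ?_
      exact (aestronglyMeasurable_rieszPressure (h3 τ (hS₀sub hτ))).mul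
        ((((contDiff_cutoff (n := 1) _).continuous_fderiv one_ne_zero).clm_apply
          (hΨcs τ))).aestronglyMeasurable
    have hlim : Tendsto (fun n : ℕ => ∫ x, F' n τ x) atTop (𝓝 (∫ x, Fl τ x)) := by
      refine tendsto_integral_filter_of_dominated_convergence (G τ) ?_ ?_ (hGi τ hτ) ?_
      · exact Eventually.of_forall hF'm
      · exact Eventually.of_forall fun n => Eventually.of_forall fun x => hbound n τ x
      · refine Eventually.of_forall fun x => tendsto_const_nhds.congr' ?_
        have hev : ∀ᶠ n : ℕ in atTop, ‖x‖ < (n : ℝ) + 1 := by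
          filter_upwards [(tendsto_natCast_atTop_atTop (R := ℝ)).eventually_gt_atTop ‖x‖] with n hn
          exact hn.trans (lt_add_one _)
        filter_upwards [hev] with n hn
        have c1 : cutoff ((n : ℝ) + 1) x = 1 := cutoff_eq_one (hR n) hn.le
        have c2 : fderiv ℝ (cutoff ((n : ℝ) + 1)) x = 0 := fderiv_cutoff_eq_zero (hR n) hn
        have c3 : (Δ (cutoff ((n : ℝ) + 1) : EuclideanSpace ℝ (Fin 3) → ℝ)) x = 0 :=
          laplacian_cutoff_eq_zero (hR n) hn
        simp [hF', hV, hFl, c1, c2, c3]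
    exact hlim.congr fun n => (hswap n τ hτ).symm
  -- (vi) the uniform bound on the inner integrals
  have hGbound : ∀ n, ∀ τ ∈ Icc 0 t, ‖∫ x, F n τ x‖ ≤ K := by
    intro n τ hτ
    rw [hswap n τ hτ]
    exact (norm_integral_le_of_norm_le (hGi τ hτ) (Eventually.of_forall (hbound n τ))).trans
      (hGint τ hτ)
  -- (vii) dominated convergence in `τ`
  have houter : Tendsto (fun n : ℕ => ∫ τ in 0..t, ∫ x, F n τ x) atTop
      (𝓝 (∫ τ in 0..t, ∫ x, Fl τ x)) := by
    refine intervalIntegral.tendsto_integral_filter_of_dominated_convergence (fun _ => K)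
      ?_ ?_ ?_ ?_
    · refine Eventually.of_forall fun n => ?_
      rw [uIoc_of_le ht0.le]
      exact ((hGc n).mono Ioc_subset_Icc_self).aestronglyMeasurable measurableSet_Ioc
    · refine Eventually.of_forall fun n => Eventually.of_forall fun τ hτ => ?_
      rw [uIoc_of_le ht0.le] at hτ
      exact hGbound n τ (Ioc_subset_Icc_self hτ)
    · exact intervalIntegrable_const
    · refine Eventually.of_forall fun τ hτ => ?_
      rw [uIoc_of_le ht0.le] at hτ
      exact hinner τ (Ioc_subset_Icc_self hτ)
  -- (viii) the boundary terms
  have hlim_t : Tendsto (fun n : ℕ => ∫ x, cutoff ((n : ℝ) + 1) x * ⟪u t x, φ x⟫) atTop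
      (𝓝 (∫ x, ⟪u t x, φ x⟫)) :=
    tendsto_integral_cutoff_mul (FluidPDE.integrable_inner_of_hasCompactSupport_right
      (hucs t ⟨ht0.le, le_rfl⟩) hφc' hφc)
  have hlim_0 : Tendsto (fun n : ℕ => ∫ x, cutoff ((n : ℝ) + 1) x * ⟪u 0 x, heatTest ν φ t x⟫)
      atTop (𝓝 (∫ x, ⟪u 0 x, heatTest ν φ t x⟫)) := by
    refine tendsto_integral_cutoff_mul ?_
    have hΨ0 : Integrable (heatTest ν φ t) (volume : Measure (EuclideanSpace ℝ (Fin 3))) :=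
      integrable_heatFlow hφint _
    have hΨ0c : Continuous (heatTest ν φ t) := (contDiff_heatFlow hφ2 hφc _).continuous
    have hΨ0b : ∀ x, ‖heatTest ν φ t x‖ ≤ Cφ := fun x => norm_heatFlow_le hCφ _ x
    refine Integrable.mono' (((hu3i 0 h0S).div_const 3).add (hΨ0.norm.const_mul (2 / 3 * Real.sqrt Cφ)))
      ((hucs 0 h0S).inner hΨ0c).aestronglyMeasurable (Eventually.of_forall fun x => ?_)
    rw [Real.norm_eq_abs]
    refine (abs_real_inner_le_norm _ _).trans ?_
    exact mul_le_of_le_sq (norm_nonneg _) (norm_nonneg _) (Real.sqrt_nonneg _)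
      (by rw [Real.sq_sqrt hCφ0]; exact hΨ0b x)
  have hEq : (∫ x, ⟪u t x, φ x⟫) - ∫ x, ⟪u 0 x, heatTest ν φ t x⟫ = ∫ τ in 0..t, ∫ x, Fl τ x :=
    tendsto_nhds_unique ((hlim_t.sub hlim_0).congr hident) houter
  -- (ix) conclusion
  show ∫ x, ⟪u t x, φ x⟫ = (∫ x, ⟪u 0 x, heatTest ν φ t x⟫) +
    (∫ τ in 0..t, ∫ x, ⟪u τ x, convect (u τ) (Ψ τ) x⟫) +
    ∫ τ in 0..t, ∫ x, ⟪(0 : ℝ → EuclideanSpace ℝ (Fin 3) → EuclideanSpace ℝ (Fin 3)) τ x, Ψ τ x⟫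
  simp only [Pi.zero_apply, inner_zero_left, integral_zero, intervalIntegral.integral_zero, add_zero]
  linarith

/-- **Classical solutions with `L³` slices are mild solutions on `[0, T)`** (Fabes–Jones–Rivière
1972, Thm. 2.1 (i), in `L³`): under the hypotheses of `isMildNSSolutionFrom_of_memLp_three` and
`T ≤ t₂`, `u` is a mild solution of the unforced system on `[0, T)` with datum `u 0`
(`IsMildNSSolutionOn (Ico 0 T) ν 0 (u 0) u`): weak divergence-freeness of the (smooth,
divergence-free) slices plus the duality identity. [cite: FabesJonesRiviere1972, Thm. 2.1 (i)] -/
theorem isMildNSSolutionOn_of_memLp_three {t₁ t₂ : ℝ}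
    (h : IsClassicalNSSolutionOn (Ioo t₁ t₂) ν 0 u p) (hν : 0 < ν) (ht₁ : t₁ < 0)
    (h3 : ∀ s ∈ Ioo t₁ t₂, MemLp (u s) 3 volume) {M : ℝ≥0}
    (hM : ∀ s ∈ Ioo t₁ t₂, eLpNorm (u s) 3 volume ≤ M) {T : ℝ} (hT : T ≤ t₂) :
    IsMildNSSolutionOn (Ico 0 T) ν 0 (u 0) u := by
  refine ⟨fun t ht => ?_, fun t ht => ?_⟩
  · have ht' : t ∈ Ioo t₁ t₂ := ⟨ht₁.trans_le ht.1, ht.2.trans_le hT⟩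
    exact VectorCalculus.IsDivFree.isWeaklyDivFree_holds (h.divFree t ht')
      (contDiff_infty.1 (h.contDiff_velocity ht') 1)
  · exact isMildNSSolutionFrom_of_memLp_three h hν ht₁ h3 hM ht.1 (ht.2.trans_le hT)

end ClassicalL3Mild

end Literature.Analysis.FluidPDE

end
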